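import Summits.ResolutionOfSingularities.ResolutionOfSingularities.Theorems.FrobeniusClosingPatchingRelPerfectMonomialPolyhedraGameDrivers
import HarnessLib

/-!
# Crux `PatchingRelPerfect` (stmt-ResolutionOfSingularities-16161), chain w52 — TargetsF3 (m) «M2-strong»,
# COMBINATORIAL HALF, Route F file F5b: THE FREE GAME IS WON; `GlobalPermissiblePolyhedraGame` HOLDS

[OURS · L1 W5.2 · background line; res-L1-w52-stub-4 g3 ROUTE-F memo §1–§2, kernel form; fact-free, characteristic-
free, no schemes; nothing here is a statement of the manuscript under review]

**`freeGame_holds : FreeGame`** and **`globalPermissiblePolyhedraGame_holds : GlobalPermissiblePolyhedraGame`** (the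
OURS target of `…MonomialPolyhedraGame.lean`, res-type-075 p507620: every finite sum of monomials on a simple normal
crossings stratum complex is principalised by blow-ups of strata INSIDE its cosupport) — by the LEVEL LOOP of ROUTE-F:
induction on the level `ν` (the maximal number of non-free indices of a non-principal stratum) and, inside a level, on
the number of non-empty classes; a class is emptied by Phase A then Phase B (`phaseA`, `phaseB`, file F5a), emptied
classes never refill and levels never rise (NP-descent); at the bottom nothing non-principal is left.  Consequence:
`routeKTarget_one_of_winnable`-free discharge of the M2-strong hypothesis consumed by the scheme dictionary
(`MonomialCleanup.monomialSumPrincipalization_of_game`, p511810) — see `…MonomialRungClosed.lean`.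

## References

* M. Spivakovsky, *A solution to Hironaka's polyhedra game* (1983). [Spivakovsky1983]
* R. Goward, *A simple algorithm for principalization of monomial ideals*, Trans. AMS 357 (2005), §2. [Goward2005]
* J. Kollár, *Lectures on Resolution of Singularities* (2007), (3.111) Step 3. [Kollar2007]
-/

-- `Summit.<Summit>.<Sub>.Theorems` with `Sub = Summit` (single-conjunct summit, D-0017)
set_option linter.dupNamespace false

namespace Summit.ResolutionOfSingularities.ResolutionOfSingularities.Theorems

namespace PolyhedraGame

open Finset

/-! ## The level loop -/

section LevelLoop

/-- [OURS] The non-empty classes at level `ν`: index sets `T° ⊆ B \ F` of size `ν` whose class is non-empty. -/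
noncomputable def liveClasses (s : State) (F : Finset ℕ) (ν : ℕ) : Finset (Finset ℕ) := by
  classical exact (s.B \ F).powerset.filter fun T₀ => T₀.card = ν ∧ cls s F T₀ ≠ ∅

/-- [OURS] Membership in `liveClasses`. -/
theorem mem_liveClasses_iff {s : State} {F : Finset ℕ} {ν : ℕ} {T₀ : Finset ℕ} :
    T₀ ∈ liveClasses s F ν ↔ T₀ ⊆ s.B \ F ∧ T₀.card = ν ∧ cls s F T₀ ≠ ∅ := by
  classical
  simp only [liveClasses, Finset.mem_filter, Finset.mem_powerset]

/-- [OURS] A non-principal stratum with exactly `ν` non-free indices gives a live class at level `ν`. -/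
theorem sdiff_mem_liveClasses {s : State} {F : Finset ℕ} (hs : s.WF) {S : Finset ℕ} (hS : S ∈ s.Str)
    (hnp : ¬ PrincipalAt s S) : S \ F ∈ liveClasses s F (S \ F).card :=
  mem_liveClasses_iff.mpr ⟨Finset.sdiff_subset_sdiff (hs.str_subset S hS) le_rfl, rfl,
    Finset.nonempty_iff_ne_empty.mp ⟨S, mem_cls_iff.mpr ⟨hS, rfl, hnp⟩⟩⟩

/-- [OURS] **Emptied classes do not refill, live classes descend**: under NP-descent and the level bound `ν`, every live class at level `ν` of the later state is a live class of the earlier one. -/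
theorem liveClasses_subset_of_desc {s s' : State} {F F' : Finset ℕ} {ν : ℕ} (hs : s.WF)
    (hdesc : NPDescends s F s' F')
    (hlev : ∀ S ∈ s.Str, ¬ PrincipalAt s S → (S \ F).card ≤ ν) :
    liveClasses s' F' ν ⊆ liveClasses s F ν := by
  intro T₀ hT₀
  obtain ⟨hsub, hcard, hne⟩ := mem_liveClasses_iff.mp hT₀
  obtain ⟨S', hS'⟩ := Finset.nonempty_iff_ne_empty.mpr hne
  obtain ⟨hS'str, hS'F, hS'np⟩ := mem_cls_iff.mp hS'
  obtain ⟨S, hS, hSnp, hSsub⟩ := hdesc S' hS'str hS'np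
  -- `T₀ = S' \ F' ⊆ S \ F`, both of size `≤ ν = |T₀|`, so they are equal
  have heq : S \ F = T₀ := by
    refine (Finset.eq_of_subset_of_card_le (hS'F ▸ hSsub) ?_).symm
    rw [hcard]; exact hlev S hS hSnp
  have := sdiff_mem_liveClasses (F := F) hs hS hSnp
  rwa [heq, hcard] at this

/-- [OURS] **THE LEVEL LOOP of ROUTE-F.**  Every well-formed state with a free index set is winnable: induction on the
level bound `ν`, then on the number of live classes at level `ν`. -/
theorem winnable_of_free_of_level : ∀ (ν n : ℕ) (s : State) (F : Finset ℕ), s.WF → Free s F →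
    (∀ S ∈ s.Str, ¬ PrincipalAt s S → (S \ F).card ≤ ν) → (liveClasses s F ν).card ≤ n → Winnable 0 s := by
  intro ν
  induction ν with
  | zero =>
    intro n
    induction n with
    | zero =>
      intro s F hs hF hlev hcount
      -- no live class at level 0 and every NP stratum at level 0: the state is principal
      refine Winnable.done fun S hS => ?_
      by_contra hnp
      have h0 : (S \ F).card = 0 := Nat.le_zero.mp (hlev S hS hnp)
      have := sdiff_mem_liveClasses (F := F) hs hS hnp
      rw [h0, Finset.card_eq_zero.mp (Nat.le_zero.mp hcount)] at this
      exact Finset.notMem_empty _ this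
    | succ n ihn =>
      intro s F hs hF hlev hcount
      exact level_step 0 n ihn s F hs hF hlev hcount
  | succ ν ihν =>
    intro n
    induction n with
    | zero =>
      intro s F hs hF hlev hcount
      -- no live class at level `ν+1`: every NP stratum has at most `ν` non-free indices
      refine ihν (liveClasses s F ν).card s F hs hF (fun S hS hnp => ?_) le_rfl
      have hle := hlev S hS hnp
      rcases hle.lt_or_eq with hlt | heq
      · omega
      · have := sdiff_mem_liveClasses (F := F) hs hS hnp
        rw [heq, Finset.card_eq_zero.mp (Nat.le_zero.mp hcount)] at this
        exact absurd this (Finset.notMem_empty _)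
    | succ n ihn =>
      intro s F hs hF hlev hcount
      exact level_step (ν + 1) n ihn s F hs hF hlev hcount
where
  /-- one class at level `ν` is emptied by Phase A then Phase B; the number of live classes drops -/
  level_step (ν n : ℕ)
      (ihn : ∀ (s : State) (F : Finset ℕ), s.WF → Free s F →
        (∀ S ∈ s.Str, ¬ PrincipalAt s S → (S \ F).card ≤ ν) → (liveClasses s F ν).card ≤ n → Winnable 0 s)
      (s : State) (F : Finset ℕ) (hs : s.WF) (hF : Free s F)
      (hlev : ∀ S ∈ s.Str, ¬ PrincipalAt s S → (S \ F).card ≤ ν)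
      (hcount : (liveClasses s F ν).card ≤ n + 1) : Winnable 0 s := by
    classical
    by_cases h0 : liveClasses s F ν = ∅
    · exact ihn s F hs hF hlev (by rw [h0, Finset.card_empty]; exact Nat.zero_le _)
    obtain ⟨T₀, hT₀⟩ := Finset.nonempty_iff_ne_empty.mpr h0
    obtain ⟨hT₀sub, hT₀card, -⟩ := mem_liveClasses_iff.mp hT₀
    refine phaseA (s₀ := s) (F₀ := F) hT₀sub (PAInv.start hs hF) fun s₁ F₁ h₁ hZ₁ => ?_
    refine phaseB (s₀ := s) (F₀ := F) hT₀sub h₁ hZ₁ fun s₂ F₂ h₂ hempty => ?_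
    -- at `s₂`: level bound kept, `T₀` no longer live, live classes descend ⇒ count ≤ n
    have hlev₂ : ∀ S ∈ s₂.Str, ¬ PrincipalAt s₂ S → (S \ F₂).card ≤ ν := by
      intro S hS hnp
      obtain ⟨S', hS', hnp', hsub⟩ := h₂.desc S hS hnp
      exact (Finset.card_le_card hsub).trans (hlev S' hS' hnp')
    refine ihn s₂ F₂ h₂.wf h₂.free hlev₂ ?_
    have hsub : liveClasses s₂ F₂ ν ⊆ (liveClasses s F ν).erase T₀ := by
      intro T₁ hT₁
      refine Finset.mem_erase.mpr ⟨fun h => ?_, liveClasses_subset_of_desc hs h₂.desc hlev hT₁⟩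
      subst h
      exact (mem_liveClasses_iff.mp hT₁).2.2 hempty
    calc (liveClasses s₂ F₂ ν).card ≤ ((liveClasses s F ν).erase T₀).card := Finset.card_le_card hsub
      _ ≤ n := by have := Finset.card_erase_of_mem hT₀; omega

end LevelLoop

/-! ## The free game is won; the global permissible polyhedra game is won -/

/-- [OURS · W5.2 M2-strong, ROUTE F] **THE FREE GAME IS WON**: from every well-formed state with a free index set,
finitely many blow-ups of strata meeting the (growing) free set reach a principal state. Characteristic-free
combinatorics; strategy = levels by the number of non-free indices, classes, Goward inside the free set on the Z-class,
mixed centres `insert f T°` driven by the defect. -/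
theorem freeGame_holds : FreeGame := fun s F hs hF =>
  winnable_of_free_of_level ((s.B \ F).card) _ s F hs hF
    (fun S hS _ => Finset.card_le_card (Finset.sdiff_subset_sdiff (hs.str_subset S hS) le_rfl)) le_rfl

/-- [OURS · W5.2 M2-strong, ROUTE F] **THE GLOBAL PERMISSIBLE POLYHEDRA GAME IS WON** (the OURS target of
`…MonomialPolyhedraGame.lean`): from every well-formed state `(B, Str, A)`, finitely many blow-ups of strata INSIDE
THE COSUPPORT of the current total-transform monomial ideal make it locally principal.  Via
`globalPermissiblePolyhedraGame_iff_freeGame` (phase one absorbs the cosupport rule) and `freeGame_holds`. -/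
theorem globalPermissiblePolyhedraGame_holds : GlobalPermissiblePolyhedraGame :=
  globalPermissiblePolyhedraGame_iff_freeGame.mpr freeGame_holds

/-- [OURS] Hence also res-type-075's marked target with marking `1`… is not needed; but for consumers phrased through
it: `Winnable 0` for every well-formed state. -/
theorem winnable_zero (s : State) (hs : s.WF) : Winnable 0 s := globalPermissiblePolyhedraGame_holds s hs

end PolyhedraGame

end Summit.ResolutionOfSingularities.ResolutionOfSingularities.Theorems
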